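/-
Copyright (c) 2026. All rights reserved.
Released under Apache 2.0 license as described in the file LICENSE.
-/
import Literature.MathematicalPhysics.QuantumFieldTheory.Balaban1983to89.B4Lemma22ReduceZero

/-!
# B4 p. 581, proof of Lemma 2.2 — the `D_Ã`-for-`D_{A₀}` CONVERSION BOUND

T. Bałaban, *Regularity and decay of lattice Green's functions*, Commun. Math. Phys. **89** (1983) 571–597 (= B4),
p. 581 [PDF 11], proof of Lemma 2.2: «Now using Lemma 2.2 for G_k(□,A₀) and the decomposition
D^η_Ã = U(A')D^η_{A₀} + F_{1,k}(A'), we have» [(2.33)] and, after (2.32), «Only here we needed the assumption that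
Ã is constant in a neighbourhood of ∂□.»; p. 580 «according to the formula D^η_A = U(A')D^η_{A₀} + F_{1,k}(A')»,
«F_{1,k}(A) = η^{−1}(U(A) − 1)».  Reading (ours, not a quotation): the norms of Lemma 2.2 taken with `D_{A₀}`
instead of `D_Ã` are interchangeable because `D^η_Ã − U(A')D^η_{A₀} = F_{1,k}(A')` is small under (2.23); this
file certifies the corresponding kernel bound.

THE KERNEL FORM.  For the lineage's covariant derivative `D^η_{W,μ}` (`B4Lemma21Region.covDeriv` on an arbitrary
region `R ⊂ ℤ^{d+1}`, mesh `η = 1/n`, Neumann convention) and [B4]'s link variables `U(κA_b)` of an orthogonal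
one-parameter flow (`B4GaugeCovariance.fieldLink`), with `Ã = A₀ + A'` bondwise (`A₀` ANY background bond function,
not necessarily constant):

* `covDeriv_sub_fld` — **`D^η_{Ã,μ} − D^η_{A₀,μ} = η^{-1}(U(κA'_b) − 1)U(κA₀,b)·(shift)`**: at a site `x` with
  `x + e_μ ∈ R`, `((D_Ã − D_{A₀})u)(x) = n·(U(κA'(x,x+e_μ)) − 1)U(κA₀(x,x+e_μ))u(x+e_μ)`, and `0` otherwise — the
  typed content of «D^η_A = U(A')D^η_{A₀} + F_{1,k}(A')» for the difference;
* `siteNorm_flow_sub_one_le` — the site-norm Lipschitz bound `|(U(t) − 1)v| ≤ ℓ|t||v|` from the lineage's squared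
  hypothesis `hLip` (`B4Lower18Regular.pertE_site_bound`'s); `siteNorm_flow` — `|U(t)v| = |v|`;
* `covDeriv_sub_siteNorm_le` / **`covDeriv_sub_supN_le`** — THE CONVERSION BOUND: if `|κA'(x, x+e_μ)| ≤ θ/n` on the
  forward `μ`-bonds of `R` ((1.7)-size regularity in lattice units, the hypothesis `hA'` of
  `B4Lower18Regular.green_box_l2_bound` / `pertE_site_bound`), then
  `‖(D^η_{Ã,μ} − D^η_{A₀,μ})u‖_∞ ≤ ℓθ‖u‖_∞` (`‖·‖_∞ = B4Lemma22Reduce231.supN`): the difference is ZEROTH-ORDER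
  small, uniformly in `η`;
* `covDeriv_sub_firstOrder` — the same in the shape of the hypothesis `hD'` of `B4Lemma22Reduce231.deriv_convert`
  (and of `B4Lemma22ReduceZero.lemma22_17_sup_field_deriv`): `‖(D_Ã − D_{A₀})u‖_∞ ≤ ℓθ(‖u‖_∞ + Σ_ν‖D_{A₀,ν}u‖_∞)`,
  for every finite family of comparison derivatives; `covDeriv_sub_supN_le_nbrs` — the all-directions form under
  the nearest-neighbour hypothesis `∀ x y, y ∈ nbrs x → |κA'(x,y)| ≤ θ/n`;
* `covDeriv_sub_l1N_le` — the `ℓ¹` version `‖(D_Ã − D_{A₀})u‖₁ ≤ ℓθ‖u‖₁`;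
* §4 `lemma22_17_sup_field_regular` — **LEMMA 2.2 (2.17), `q = p = ∞`, `n = 0,1` IN BOTH DERIVATIVE CONVENTIONS,
  FOR [B4]'s `G_k(□,Ã)` ON A FINE BOX, ONE HYPOTHESIS AWAY**: `B4Lemma22ReduceZero.lemma22_17_sup_field[_deriv]`
  (constant-configuration bounds PROVED there; (2.31) for `b4Green` via `b4Op_add`) with the conversion hypothesis
  discharged here: IF `H(□,Ã)` is invertible, `V = pertV` is first-order small w.r.t. `D_{A₀}` in `‖·‖_∞` with
  `(d+2)cε ≤ 1/2`, and `|κA′_b| ≤ θ/n` on nearest-neighbour bonds, THEN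
  `‖GΦ‖_∞ + Σ_μ‖D^η_{A₀,μ}GΦ‖_∞ ≤ 2(d+2)c‖Φ‖_∞` and `‖D^η_{Ã,μ}GΦ‖_∞ ≤ (1+ℓθ)2(d+2)c‖Φ‖_∞` (`G = G_k(□,Ã)`), one
  constant `c` uniform over the window, the box, the contour system, `A₀`, `A′`.

HONEST SCOPE: this is the `D_{A₀} ↔ D_Ã` conversion only (one of the two inputs the (2.31)–(2.33) bootstrap needs
besides the constant-configuration bounds); the first-order smallness of the perturbation `V_k` itself
((2.25)/(2.32)) is NOT treated here.  The printed «constant in a neighbourhood of ∂□» is not needed for this bound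
(it is needed for `V_k`).  Constants: `φ = ℓθ` (printed: `O(1)e^βc₂`-small since `θ = O(e^β)` under (1.7)).
No step of the manuscript is used as a hypothesis of a theorem claiming a printed conclusion; 0 cited facts;
standard axioms only.

v1.1 (DOCFIX, 2026-08-19; XREAD pv15-g10 D1/T1, ref6-g40 M1): the header and the docstring of
`covDeriv_sub_supN_le` formerly set an unprinted paraphrase in «»; replaced by the verbatim p. 580/581 sentences
plus a sentence labelled as our reading; «neighbourhood» and «η^{−1}» set as printed; no Lean statement or proof
changed.
-/

namespace Literature.MathematicalPhysics.QuantumFieldTheory.Balaban1983to89.B4Lemma22ReduceDeriv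

open Finset Matrix
open Literature.MathematicalPhysics.QuantumFieldTheory.Balaban1983to89.B4GaugeCovariance (fld fld_apply OrthFlow
  fieldLink IsGauge)
open Literature.MathematicalPhysics.QuantumFieldTheory.Balaban1983to89.B4Lower18Regular (e1 kmul kmul_apply
  fieldLink_add dotProduct_self_nonneg')
open Literature.MathematicalPhysics.QuantumFieldTheory.Balaban1983to89.B4Lemma21Region (siteNorm covDeriv dirKer
  fld_covDeriv_mulVec_of_mem fld_covDeriv_mulVec_of_not_mem)
open Literature.MathematicalPhysics.QuantumFieldTheory.Balaban1983to89.B4Reflection242 (nbrs mem_nbrs)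
open Literature.MathematicalPhysics.QuantumFieldTheory.Balaban1983to89.B4Lemma22Reduce231

noncomputable section

variable {ι : Type} [Fintype ι] [DecidableEq ι]

/-! ## §1 Site-norm facts for the flow -/

/-- **`|(U(t) − 1)v| ≤ ℓ|t|·|v|`** — the site-norm form of the lineage's Lipschitz hypothesis on the flow
(`hLip`, squared form). [folklore] -/
theorem siteNorm_flow_sub_one_le (F : OrthFlow ι) {ℓ : ℝ} (hℓ : 0 ≤ ℓ)
    (hLip : ∀ t (v : ι → ℝ), ((F.U t - 1) *ᵥ v) ⬝ᵥ ((F.U t - 1) *ᵥ v) ≤ (ℓ * t) ^ 2 * (v ⬝ᵥ v))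
    (t : ℝ) (v : ι → ℝ) : siteNorm ((F.U t - 1) *ᵥ v) ≤ ℓ * |t| * siteNorm v := by
  unfold siteNorm
  have h1 : ℓ * |t| = Real.sqrt ((ℓ * t) ^ 2) := by
    rw [Real.sqrt_sq_eq_abs, abs_mul, abs_of_nonneg hℓ]
  rw [h1, ← Real.sqrt_mul' _ (dotProduct_self_nonneg' v)]
  exact Real.sqrt_le_sqrt (hLip t v)

/-- `|U(t)v| = |v|` (orthogonality). [folklore] -/
theorem siteNorm_flow (F : OrthFlow ι) (t : ℝ) (v : ι → ℝ) : siteNorm (F.U t *ᵥ v) = siteNorm v := by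
  unfold siteNorm
  rw [(F.isGauge (fun _ : Unit => t)).dotProduct_mulVec_self ()]

/-! ## §2 The difference `D_Ã − D_{A₀}` sitewise -/

variable {d : ℕ}

omit [Fintype ι] [DecidableEq ι] in
/-- `fld` is additive: `fld (Φ − Ψ) = fld Φ − fld Ψ`. [folklore] -/
theorem fld_sub {X : Type*} (Φ Ψ : X × ι → ℝ) (x : X) : fld (Φ - Ψ) x = fld Φ x - fld Ψ x := rfl

/-- **`U(κ(A₀ + A')_b) − U(κA₀,b) = (U(κA'_b) − 1)·U(κA₀,b)`** (the abelian flow, `B4Lower18Regular.fieldLink_add`).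
[cite: Balaban1983RegularityDecay, p. 580 «D^η_A = U(A')D^η_{A₀} + F_{1,k}(A')»] -/
theorem fieldLink_add_sub {X : Type*} (F : OrthFlow ι) (κ : ℝ) (A₀ A' : X → X → ℝ) (x y : X) :
    fieldLink F κ (A₀ + A') x y - fieldLink F κ A₀ x y = (F.U (κ * A' x y) - 1) * fieldLink F κ A₀ x y := by
  rw [fieldLink_add, kmul_apply, sub_mul, one_mul]
  rfl

/-- **THE DIFFERENCE OF COVARIANT DERIVATIVES AT A BOND INSIDE THE REGION**:
`((D^η_{Ã,μ} − D^η_{A₀,μ})u)(x) = n·(U(κA'(x,x+e_μ)) − 1)·U(κA₀(x,x+e_μ))·u(x+e_μ)`.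
[cite: Balaban1983RegularityDecay, p. 580; p. 572 (1.3)] -/
theorem covDeriv_sub_fld_of_mem (F : OrthFlow ι) (κ : ℝ) (n : ℕ) {R : Finset (Fin (d + 1) → ℤ)}
    (A₀ A' : ↥R → ↥R → ℝ) {μ : Fin (d + 1)} (u : ↥R × ι → ℝ) {x : ↥R} (h : x.1 + e1 μ ∈ R) :
    fld ((covDeriv n R (fieldLink F κ (A₀ + A')) μ - covDeriv n R (fieldLink F κ A₀) μ) *ᵥ u) x
      = (n : ℝ) • ((F.U (κ * A' x ⟨x.1 + e1 μ, h⟩) - 1)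
          *ᵥ (fieldLink F κ A₀ x ⟨x.1 + e1 μ, h⟩ *ᵥ fld u ⟨x.1 + e1 μ, h⟩)) := by
  rw [sub_mulVec, fld_sub, fld_covDeriv_mulVec_of_mem n _ u h, fld_covDeriv_mulVec_of_mem n _ u h, ← smul_sub,
    sub_sub_sub_cancel_right, ← sub_mulVec, fieldLink_add_sub, ← mulVec_mulVec]

/-- no bond, no difference. [cite: Balaban1983RegularityDecay, p. 572 (1.3)] -/
theorem covDeriv_sub_fld_of_not_mem (F : OrthFlow ι) (κ : ℝ) (n : ℕ) {R : Finset (Fin (d + 1) → ℤ)}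
    (A₀ A' : ↥R → ↥R → ℝ) {μ : Fin (d + 1)} (u : ↥R × ι → ℝ) {x : ↥R} (h : x.1 + e1 μ ∉ R) :
    fld ((covDeriv n R (fieldLink F κ (A₀ + A')) μ - covDeriv n R (fieldLink F κ A₀) μ) *ᵥ u) x = 0 := by
  rw [sub_mulVec, fld_sub, fld_covDeriv_mulVec_of_not_mem n _ u h, fld_covDeriv_mulVec_of_not_mem n _ u h,
    sub_zero]

/-! ## §3 The conversion bound -/

/-- **SITEWISE CONVERSION BOUND**: under `|κA'(x, x+e_μ)| ≤ θ/n`,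
`|((D^η_{Ã,μ} − D^η_{A₀,μ})u)(x)| ≤ ℓθ·|u(x+e_μ)|` (`≤ ℓθ‖u‖_∞`) — the factor `η^{-1} = n` of the derivative is
compensated by the `η` in `κA' = eηA'`. [cite: Balaban1983RegularityDecay, p. 581] -/
theorem covDeriv_sub_siteNorm_le (F : OrthFlow ι) {ℓ : ℝ} (hℓ : 0 ≤ ℓ)
    (hLip : ∀ t (v : ι → ℝ), ((F.U t - 1) *ᵥ v) ⬝ᵥ ((F.U t - 1) *ᵥ v) ≤ (ℓ * t) ^ 2 * (v ⬝ᵥ v))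
    (κ : ℝ) {n : ℕ} (hn : 1 ≤ n) {R : Finset (Fin (d + 1) → ℤ)} (A₀ : ↥R → ↥R → ℝ) {A' : ↥R → ↥R → ℝ}
    {μ : Fin (d + 1)} {θ : ℝ} (hθ : 0 ≤ θ) (hA' : ∀ x y : ↥R, y.1 = x.1 + e1 μ → |κ * A' x y| ≤ θ / n)
    (u : ↥R × ι → ℝ) (x : ↥R) :
    siteNorm (fld ((covDeriv n R (fieldLink F κ (A₀ + A')) μ - covDeriv n R (fieldLink F κ A₀) μ) *ᵥ u) x)
      ≤ ℓ * θ * supN u := by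
  have hn0 : (0 : ℝ) < n := by exact_mod_cast hn
  by_cases h : x.1 + e1 μ ∈ R
  · rw [covDeriv_sub_fld_of_mem F κ n A₀ A' u h, siteNorm_smul, Nat.abs_cast]
    have h1 := siteNorm_flow_sub_one_le F hℓ hLip (κ * A' x ⟨x.1 + e1 μ, h⟩)
      (fieldLink F κ A₀ x ⟨x.1 + e1 μ, h⟩ *ᵥ fld u ⟨x.1 + e1 μ, h⟩)
    have h2 : siteNorm (fieldLink F κ A₀ x ⟨x.1 + e1 μ, h⟩ *ᵥ fld u ⟨x.1 + e1 μ, h⟩)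
        = siteNorm (fld u ⟨x.1 + e1 μ, h⟩) := siteNorm_flow F _ _
    have h3 := hA' x ⟨x.1 + e1 μ, h⟩ rfl
    have h4 := le_supN u ⟨x.1 + e1 μ, h⟩
    have h5 : 0 ≤ siteNorm (fld u ⟨x.1 + e1 μ, h⟩) := siteNorm_nonneg _
    rw [h2] at h1
    calc (n : ℝ) * siteNorm ((F.U (κ * A' x ⟨x.1 + e1 μ, h⟩) - 1)
            *ᵥ (fieldLink F κ A₀ x ⟨x.1 + e1 μ, h⟩ *ᵥ fld u ⟨x.1 + e1 μ, h⟩))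
          ≤ (n : ℝ) * (ℓ * (θ / n) * siteNorm (fld u ⟨x.1 + e1 μ, h⟩)) := by
            refine mul_le_mul_of_nonneg_left (h1.trans ?_) hn0.le
            exact mul_le_mul_of_nonneg_right (mul_le_mul_of_nonneg_left h3 hℓ) h5
      _ = ℓ * θ * siteNorm (fld u ⟨x.1 + e1 μ, h⟩) := by
            field_simp
      _ ≤ ℓ * θ * supN u := mul_le_mul_of_nonneg_left h4 (mul_nonneg hℓ hθ)
  · rw [covDeriv_sub_fld_of_not_mem F κ n A₀ A' u h, siteNorm_zero]
    exact mul_nonneg (mul_nonneg hℓ hθ) (supN_nonneg u)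

/-- **THE CONVERSION BOUND `‖(D^η_{Ã,μ} − D^η_{A₀,μ})u‖_∞ ≤ ℓθ‖u‖_∞`** (kernel form of our reading of p. 580
«D^η_A = U(A')D^η_{A₀} + F_{1,k}(A')» under the size bound of (2.23)).
[cite: Balaban1983RegularityDecay, p. 580; p. 579 (2.23)] -/
theorem covDeriv_sub_supN_le (F : OrthFlow ι) {ℓ : ℝ} (hℓ : 0 ≤ ℓ)
    (hLip : ∀ t (v : ι → ℝ), ((F.U t - 1) *ᵥ v) ⬝ᵥ ((F.U t - 1) *ᵥ v) ≤ (ℓ * t) ^ 2 * (v ⬝ᵥ v))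
    (κ : ℝ) {n : ℕ} (hn : 1 ≤ n) {R : Finset (Fin (d + 1) → ℤ)} (A₀ : ↥R → ↥R → ℝ) {A' : ↥R → ↥R → ℝ}
    {μ : Fin (d + 1)} {θ : ℝ} (hθ : 0 ≤ θ) (hA' : ∀ x y : ↥R, y.1 = x.1 + e1 μ → |κ * A' x y| ≤ θ / n)
    (u : ↥R × ι → ℝ) :
    supN ((covDeriv n R (fieldLink F κ (A₀ + A')) μ - covDeriv n R (fieldLink F κ A₀) μ) *ᵥ u)
      ≤ ℓ * θ * supN u :=
  supN_le (mul_nonneg (mul_nonneg hℓ hθ) (supN_nonneg u))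
    fun x => covDeriv_sub_siteNorm_le F hℓ hLip κ hn A₀ hθ hA' u x

/-- the conversion bound IN THE SHAPE OF THE HYPOTHESIS `hD'` of `B4Lemma22Reduce231.deriv_convert` /
`B4Lemma22ReduceZero.lemma22_17_sup_field_deriv`: for every finite comparison family `D`,
`‖(D_Ã − D_{A₀})u‖_∞ ≤ ℓθ·(‖u‖_∞ + Σ_ν ‖D_ν u‖_∞)`. [cite: Balaban1983RegularityDecay, p. 581] -/
theorem covDeriv_sub_firstOrder (F : OrthFlow ι) {ℓ : ℝ} (hℓ : 0 ≤ ℓ)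
    (hLip : ∀ t (v : ι → ℝ), ((F.U t - 1) *ᵥ v) ⬝ᵥ ((F.U t - 1) *ᵥ v) ≤ (ℓ * t) ^ 2 * (v ⬝ᵥ v))
    (κ : ℝ) {n : ℕ} (hn : 1 ≤ n) {R : Finset (Fin (d + 1) → ℤ)} (A₀ : ↥R → ↥R → ℝ) {A' : ↥R → ↥R → ℝ}
    {μ : Fin (d + 1)} {θ : ℝ} (hθ : 0 ≤ θ) (hA' : ∀ x y : ↥R, y.1 = x.1 + e1 μ → |κ * A' x y| ≤ θ / n)
    {K : Type*} [Fintype K] (D : K → Matrix (↥R × ι) (↥R × ι) ℝ) (u : ↥R × ι → ℝ) :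
    supN ((covDeriv n R (fieldLink F κ (A₀ + A')) μ - covDeriv n R (fieldLink F κ A₀) μ) *ᵥ u)
      ≤ ℓ * θ * (supN u + ∑ ν, supN (D ν *ᵥ u)) := by
  refine (covDeriv_sub_supN_le F hℓ hLip κ hn A₀ hθ hA' u).trans ?_
  refine mul_le_mul_of_nonneg_left ?_ (mul_nonneg hℓ hθ)
  have : 0 ≤ ∑ ν, supN (D ν *ᵥ u) := sum_nonneg fun ν _ => supN_nonneg _
  linarith

omit [Fintype ι] [DecidableEq ι] in
/-- forward bonds are nearest-neighbour pairs. [folklore] -/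
theorem add_e1_mem_nbrs (x : Fin (d + 1) → ℤ) (μ : Fin (d + 1)) : x + e1 μ ∈ nbrs x :=
  mem_nbrs.2 ⟨μ, Or.inl rfl⟩

/-- the all-directions form under the NEAREST-NEIGHBOUR size hypothesis of the lineage
(`B4Lower18Regular.green_box_l2_bound`'s `hA`, with `A' = A − A₀`): for every `μ`,
`‖(D^η_{Ã,μ} − D^η_{A₀,μ})u‖_∞ ≤ ℓθ‖u‖_∞`. [cite: Balaban1983RegularityDecay, p. 581] -/
theorem covDeriv_sub_supN_le_nbrs (F : OrthFlow ι) {ℓ : ℝ} (hℓ : 0 ≤ ℓ)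
    (hLip : ∀ t (v : ι → ℝ), ((F.U t - 1) *ᵥ v) ⬝ᵥ ((F.U t - 1) *ᵥ v) ≤ (ℓ * t) ^ 2 * (v ⬝ᵥ v))
    (κ : ℝ) {n : ℕ} (hn : 1 ≤ n) {R : Finset (Fin (d + 1) → ℤ)} (A₀ : ↥R → ↥R → ℝ) {A' : ↥R → ↥R → ℝ}
    {θ : ℝ} (hθ : 0 ≤ θ) (hA' : ∀ x y : ↥R, y.1 ∈ nbrs x.1 → |κ * A' x y| ≤ θ / n)
    (μ : Fin (d + 1)) (u : ↥R × ι → ℝ) :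
    supN ((covDeriv n R (fieldLink F κ (A₀ + A')) μ - covDeriv n R (fieldLink F κ A₀) μ) *ᵥ u)
      ≤ ℓ * θ * supN u :=
  covDeriv_sub_supN_le F hℓ hLip κ hn A₀ hθ (fun x y hy => hA' x y (hy ▸ add_e1_mem_nbrs x.1 μ)) u

/-- **THE `ℓ¹` CONVERSION BOUND `‖(D^η_{Ã,μ} − D^η_{A₀,μ})u‖₁ ≤ ℓθ‖u‖₁`** (each site `x + e_μ` is hit by at most one
forward bond). [cite: Balaban1983RegularityDecay, p. 581] -/
theorem covDeriv_sub_l1N_le (F : OrthFlow ι) {ℓ : ℝ} (hℓ : 0 ≤ ℓ)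
    (hLip : ∀ t (v : ι → ℝ), ((F.U t - 1) *ᵥ v) ⬝ᵥ ((F.U t - 1) *ᵥ v) ≤ (ℓ * t) ^ 2 * (v ⬝ᵥ v))
    (κ : ℝ) {n : ℕ} (hn : 1 ≤ n) {R : Finset (Fin (d + 1) → ℤ)} (A₀ : ↥R → ↥R → ℝ) {A' : ↥R → ↥R → ℝ}
    {μ : Fin (d + 1)} {θ : ℝ} (hθ : 0 ≤ θ) (hA' : ∀ x y : ↥R, y.1 = x.1 + e1 μ → |κ * A' x y| ≤ θ / n)
    (u : ↥R × ι → ℝ) :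
    l1N ((covDeriv n R (fieldLink F κ (A₀ + A')) μ - covDeriv n R (fieldLink F κ A₀) μ) *ᵥ u)
      ≤ ℓ * θ * l1N u := by
  have hn0 : (0 : ℝ) < n := by exact_mod_cast hn
  -- sitewise: `|((D_Ã − D_{A₀})u)(x)| ≤ ℓθ · |u(x + e_μ)|·1[x + e_μ ∈ R]`
  let g : ↥R → ℝ := fun x =>
    if h : x.1 + e1 μ ∈ R then ℓ * θ * siteNorm (fld u ⟨x.1 + e1 μ, h⟩) else 0
  have hsite : ∀ x, siteNorm (fld ((covDeriv n R (fieldLink F κ (A₀ + A')) μ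
      - covDeriv n R (fieldLink F κ A₀) μ) *ᵥ u) x) ≤ g x := by
    intro x
    by_cases h : x.1 + e1 μ ∈ R
    · simp only [g, dif_pos h]
      rw [covDeriv_sub_fld_of_mem F κ n A₀ A' u h, siteNorm_smul, Nat.abs_cast]
      have h1 := siteNorm_flow_sub_one_le F hℓ hLip (κ * A' x ⟨x.1 + e1 μ, h⟩)
        (fieldLink F κ A₀ x ⟨x.1 + e1 μ, h⟩ *ᵥ fld u ⟨x.1 + e1 μ, h⟩)
      have h2 : siteNorm (fieldLink F κ A₀ x ⟨x.1 + e1 μ, h⟩ *ᵥ fld u ⟨x.1 + e1 μ, h⟩)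
          = siteNorm (fld u ⟨x.1 + e1 μ, h⟩) := siteNorm_flow F _ _
      rw [h2] at h1
      have h3 := hA' x ⟨x.1 + e1 μ, h⟩ rfl
      have h5 : 0 ≤ siteNorm (fld u ⟨x.1 + e1 μ, h⟩) := siteNorm_nonneg _
      calc (n : ℝ) * siteNorm ((F.U (κ * A' x ⟨x.1 + e1 μ, h⟩) - 1)
              *ᵥ (fieldLink F κ A₀ x ⟨x.1 + e1 μ, h⟩ *ᵥ fld u ⟨x.1 + e1 μ, h⟩))
            ≤ (n : ℝ) * (ℓ * (θ / n) * siteNorm (fld u ⟨x.1 + e1 μ, h⟩)) := by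
              refine mul_le_mul_of_nonneg_left (h1.trans ?_) hn0.le
              exact mul_le_mul_of_nonneg_right (mul_le_mul_of_nonneg_left h3 hℓ) h5
        _ = ℓ * θ * siteNorm (fld u ⟨x.1 + e1 μ, h⟩) := by field_simp
    · simp only [g, dif_neg h]
      rw [covDeriv_sub_fld_of_not_mem F κ n A₀ A' u h, siteNorm_zero]
  -- sum over sites: reindex the forward shift `x ↦ x + e_μ` (injective) into a sum over all sites
  have hsum : ∑ x, g x ≤ ℓ * θ * l1N u := by
    have hg : ∀ x, g x = ∑ z : ↥R, if z.1 = x.1 + e1 μ then ℓ * θ * siteNorm (fld u z) else 0 := by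
      intro x
      by_cases h : x.1 + e1 μ ∈ R
      · simp only [g, dif_pos h]
        rw [Finset.sum_eq_single ⟨x.1 + e1 μ, h⟩]
        · rw [if_pos rfl]
        · intro z _ hz
          rw [if_neg]
          intro hz1
          exact hz (Subtype.ext hz1)
        · intro hh; exact absurd (Finset.mem_univ _) hh
      · simp only [g, dif_neg h]
        symm
        refine Finset.sum_eq_zero fun z _ => ?_
        rw [if_neg]
        intro hz
        exact h (hz ▸ z.2)
    simp_rw [hg]
    rw [Finset.sum_comm]
    unfold l1N
    rw [Finset.mul_sum]
    refine Finset.sum_le_sum fun z _ => ?_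
    have hz0 : 0 ≤ ℓ * θ * siteNorm (fld u z) := mul_nonneg (mul_nonneg hℓ hθ) (siteNorm_nonneg _)
    calc ∑ x : ↥R, (if z.1 = x.1 + e1 μ then ℓ * θ * siteNorm (fld u z) else 0)
          = ∑ x ∈ (Finset.univ.filter fun x : ↥R => z.1 = x.1 + e1 μ), ℓ * θ * siteNorm (fld u z) := by
            rw [Finset.sum_filter]
      _ ≤ ℓ * θ * siteNorm (fld u z) := by
            rw [Finset.sum_const, nsmul_eq_mul]
            have hcard : ((Finset.univ.filter fun x : ↥R => z.1 = x.1 + e1 μ).card : ℝ) ≤ 1 := by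
              have : (Finset.univ.filter fun x : ↥R => z.1 = x.1 + e1 μ).card ≤ 1 := by
                refine Finset.card_le_one.2 fun a ha b hb => ?_
                rw [Finset.mem_filter] at ha hb
                exact Subtype.ext (add_right_cancel (ha.2.symm.trans hb.2))
              exact_mod_cast this
            nlinarith
  unfold l1N
  exact (Finset.sum_le_sum fun x _ => hsite x).trans (by unfold l1N at hsum; exact hsum)

/-! ## §4 LEMMA 2.2 (2.17), `q = p = ∞`, `n = 0,1` (BOTH derivative conventions) FOR [B4]'s `G_k(□,Ã)`, with the
conversion discharged -/

section Field

variable {d : ℕ}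

open Literature.MathematicalPhysics.QuantumFieldTheory.Balaban1983to89.B4Reflection242 (boxDom)
open Literature.MathematicalPhysics.QuantumFieldTheory.Balaban1983to89.B4GaugeCovariance (blkWt pathEnd constBond)
open Literature.MathematicalPhysics.QuantumFieldTheory.Balaban1983to89.B4Lemma22ReduceZero (Box greenA greenA0 opA
  pertV derivA derivA0 const_box_sup greenA_resolvent card_dir_add_one)

/-- **LEMMA 2.2 (2.17), `q = p = ∞`, `n = 0,1`, FOR [B4]'s `G_k(□,Ã)`, `Ã = A₀ + A′` (1.7)-SIZE-REGULAR, ONE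
HYPOTHESIS AWAY** — `B4Lemma22ReduceZero.lemma22_17_sup_field[_deriv]` with the `D_Ã`-for-`D_{A₀}` conversion
hypothesis DISCHARGED by `covDeriv_sub_firstOrder`: on a fine box, IF `H(□,Ã)` is invertible, [B4]'s perturbation
`V` (`pertV`) is first-order small in `‖·‖_∞` w.r.t. `D_{A₀}` with `(d+2)cε ≤ 1/2` (THE remaining input,
(2.25)/(2.32)), and `|κA′_b| ≤ θ/n` on nearest-neighbour bonds, THEN for every `Φ`:
`‖GΦ‖_∞ + Σ_μ‖D^η_{A₀,μ}GΦ‖_∞ ≤ 2(d+2)c‖Φ‖_∞` and `‖D^η_{Ã,μ}GΦ‖_∞ ≤ (1 + ℓθ)·2(d+2)c‖Φ‖_∞`, `G = G_k(□,Ã)`,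
with ONE constant `c` uniform over the window, the box, the contour system, `A₀`, `A′`.
[cite: Balaban1983RegularityDecay, Lemma 2.2 (2.17) p. 578; proof p. 581 (2.31)–(2.33)] -/
theorem lemma22_17_sup_field_regular (F : OrthFlow ι) {ℓ₁ : ℝ} (hℓ₁ : 0 ≤ ℓ₁)
    (hLip : ∀ t (v : ι → ℝ), ((F.U t - 1) *ᵥ v) ⬝ᵥ ((F.U t - 1) *ᵥ v) ≤ (ℓ₁ * t) ^ 2 * (v ⬝ᵥ v))
    (κ : ℝ) (d ℓ : ℕ) (hℓ : 1 ≤ ℓ) (amin aplus m2plus : ℝ) (ha : 0 < amin) :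
    ∃ c : ℝ, 0 < c ∧ ∀ (k : ℕ), 1 ≤ k → ∀ (a m2 : ℝ), amin ≤ a → a ≤ aplus → 0 ≤ m2 → m2 ≤ m2plus →
      ∀ (M : Fin (d + 1) → ℕ), (∀ i, 1 ≤ M i) →
      ∀ (emb : ↥(boxDom M) → ↥(Box d ℓ k M)) (Γ : ↥(boxDom M) → ↥(Box d ℓ k M) → List ↥(Box d ℓ k M)),
        (∀ y x, blkWt ((ℓ + 1) ^ k) M (fun i => (ℓ + 1) ^ k * M i) y x ≠ 0 → pathEnd (emb y) (Γ y x) = x) →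
      ∀ (A₀ : Fin (d + 1) → ℝ) (A' : ↥(Box d ℓ k M) → ↥(Box d ℓ k M) → ℝ) (ε θ : ℝ),
        IsUnit (opA d F κ ℓ k a m2 M emb Γ (constBond A₀ Subtype.val + A')).det →
        FirstOrderSmall supN (pertV d F κ ℓ k a M emb Γ A₀ A') (derivA0 d F κ ℓ k M A₀) ε →
        ((d : ℝ) + 2) * c * ε ≤ 1 / 2 → 0 ≤ θ →
        (∀ x y : ↥(Box d ℓ k M), y.1 ∈ nbrs x.1 → |κ * A' x y| ≤ θ / ((ℓ + 1) ^ k : ℕ)) →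
        ∀ Φ : ↥(Box d ℓ k M) × ι → ℝ,
          supN (greenA d F κ ℓ k a m2 M emb Γ (constBond A₀ Subtype.val + A') *ᵥ Φ)
              + ∑ μ, supN (derivA0 d F κ ℓ k M A₀ μ
                  *ᵥ (greenA d F κ ℓ k a m2 M emb Γ (constBond A₀ Subtype.val + A') *ᵥ Φ))
              ≤ 2 * (((d : ℝ) + 2) * c) * supN Φ ∧
          ∀ μ : Fin (d + 1),
            supN (derivA d F κ ℓ k M (constBond A₀ Subtype.val + A') μ
                *ᵥ (greenA d F κ ℓ k a m2 M emb Γ (constBond A₀ Subtype.val + A') *ᵥ Φ))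
              ≤ (1 + ℓ₁ * θ) * (2 * (((d : ℝ) + 2) * c)) * supN Φ := by
  obtain ⟨c, hc, h⟩ := const_box_sup F κ d ℓ hℓ amin aplus m2plus ha
  refine ⟨c, hc, ?_⟩
  intro k hk a m2 e1' e2 e3 e4 M hM emb Γ hend A₀ A' ε θ hunit hV hsm hθ hA' Φ
  obtain ⟨h0, hD⟩ := h k hk a m2 e1' e2 e3 e4 M hM emb Γ hend A₀
  have hres := greenA_resolvent F κ hℓ hk (lt_of_lt_of_le ha e1') e3 hM hend A₀ hunit
  have hsm' : ((Fintype.card (Fin (d + 1)) : ℝ) + 1) * c * ε ≤ 1 / 2 := by rw [card_dir_add_one]; exact hsm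
  have hn : 1 ≤ (ℓ + 1) ^ k := Nat.one_le_pow _ _ (Nat.succ_pos ℓ)
  have hD' : ∀ (μ : Fin (d + 1)) (u : ↥(Box d ℓ k M) × ι → ℝ),
      supN ((derivA d F κ ℓ k M (constBond A₀ Subtype.val + A') μ - derivA0 d F κ ℓ k M A₀ μ) *ᵥ u)
        ≤ ℓ₁ * θ * (supN u + ∑ ν', supN (derivA0 d F κ ℓ k M A₀ ν' *ᵥ u)) := fun μ u =>
    covDeriv_sub_firstOrder F hℓ₁ hLip κ hn (constBond A₀ Subtype.val) hθ
      (fun x y hy => hA' x y (hy ▸ add_e1_mem_nbrs x.1 μ)) _ u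
  refine ⟨?_, fun μ => ?_⟩
  · have key := reduce_sup (κ := Fin (d + 1)) hres hc.le h0 hD hV hsm' Φ
    rw [card_dir_add_one] at key
    exact key
  · have key := deriv_convert (κ := Fin (d + 1)) supN_nonneg supN_add_le hres hc.le h0 hD hV hsm'
      (mul_nonneg hℓ₁ hθ) hD' μ Φ
    rw [card_dir_add_one] at key
    exact key

end Field

end

end Literature.MathematicalPhysics.QuantumFieldTheory.Balaban1983to89.B4Lemma22ReduceDeriv
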